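import Mathlib
import Literature.MathematicalPhysics.QuantumFieldTheory.Balaban1983to89.B11

/-!
# T4R1Response — the RESIDUAL-SEPARATED response radius read off Bałaban's displayed fixed-point inequalities (117), (120)–(121) (cell `pub-balaban`, T4-DAG v2 node U1 (b), sub-estimate R1 of NE3, row T4-U1b.L3°; bookkeeping)

HONEST FRAMING (cell `pub-balaban`, T4-DAG PAGE 1).  The cell's T4 target is the existence AND uniqueness of the
continuum limit of Bałaban's unit-scale averaged loop expectations on a finite torus — a constructive-QFT statement
strictly beyond ultraviolet stability; it is NOT the Yang–Mills mass gap and NOT the Clay problem.  This module is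
pure bookkeeping for the sub-estimate R1 ("response bound") of the cell's NEW ESTIMATE NE3 ("η-rate of the
minimisers"): §1 is elementary real arithmetic; §2 is a HYPOTHESIS SHAPE over the abstract carrier `B11.LGData` of
the tree (a predicate, never used as a fact) and one implication between shapes.  It asserts NOTHING about Bałaban's
minimal configurations, operators or norms.  Record: HOME/t4/T4-XREAD-U1b-L3.md (this seat), GAPS G-pv21g3-1, G-pv21g3-2.
Value = kernel certificate of a six-line [analysis] corollary of displayed formulas + a typed shape; NOT summit
progress.

PRINTED CONTEXT (verbatim; read by this seat on the rendered journal pages of T. Bałaban, CMP 102 (1985) 277–309 =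
[Balaban1985Variational] — a manuscript under audit, quoted for what it STATES, never as establishing a disputed
step).
* p. 295, the response mechanism for Eq. (111) "A₁ + 𝔊J + 𝔊((δ/δA′)V)(A₁ + H₁B) = 0. (111)" (p. 294) in the space
  "(115)" = "max{|A₁|_(−1), |∇A₁|_(−2)} < ε₄": "We will prove that for ε₄ sufficiently small the equation has a
  unique solution, and the solution is in the space (115) with ε₄ = O(ε₁). A solution of Eq. (111) is a fixed point
  of the transformation A₁ → −𝔊J − 𝔊((δ/δA′)V)(A₁ + H₁B). (116) At first let us investigate for which ε₄ this
  transformation maps the space (115) into itself. By Theorem 3.13 of [5] the norm max{|·|_(−1), |∇·|_(−2)} of the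
  transformation can be estimated by B₀|J|_(−3) + B₀|((δ/δA′)V)(A₁ + H₁B)|_(−3) < B₀C₁B₃ε₁ + B₀C₄(ε₄ + B₀|B|)²,
  (117) if ε₄ + B₀|B| ≤ a₃." … "= 4B₀C₄(ε₄ + B₀|B|)max{|A₁ − A₂|_(−1), |∇(A₁ − A₂)|_(−2)}, (120) where we have
  taken r = (ε₄ + B₀|B|)(max{|A₁ − A₂|_(−1), |∇(A₁ − A₂)|_(−2)})⁻¹. We have to assume also that 2(ε₄ + B₀|B|) ≤ a₃,
  in order to be able to apply Proposition 4. Thus the transformation is contractive if 2ε₄ + 4dLB₀C₁ε₁ ≤ a₃,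
  4B₀C₄(ε₄ + 2dLB₀C₁ε₁) ≤ ½. (121)" … "Proposition 6. There exists a positive, absolute constant a₄ such, that
  for ε₄ ≤ a₄ and ε₁ satisfying 2B₀C₁B₃ε₁ ≤ ε₄ Eq. (111) has exactly one solution in the space (115). This
  solution satisfies the bounds (115) with ε₄ = 3B₀C₁B₃ε₁."  [cite: Balaban1985Variational, (115)–(121), Prop. 6
  pp. 294–296]
* p. 293, Prop. 4: "|((δ/δA′)V)(A′)|_(−3) ≤ C₄(max{|A′|_(−1), |∇A′|_(−2)})², (98) and it is valid if
  max{|A′|_(−1), |∇A′|_(−2)} ≤ a₃." and "The constants a₃, C₄ depend on d and L only."; (103): "|H₁B| <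
  B₀2dLC₁ε₁(L^jη)⁻¹, |∇H₁B| < B₀2dLC₁ε₁(L^jη)⁻² on Ω_j".  [cite: Balaban1985Variational, Prop. 4 (98), (103) p. 293]
* p. 282: "J = D*η⁻² Im ∂U₀ = Im η⁻²D*∂U₀, |J| < C₁B₃ε₁(L^jη)⁻³ on Ω_j, (28) the bound holds by the assumption
  (14)."; p. 280: "Having in view future applications we will consider a little bit more general configuration U₀
  than this constructed above. We assume that we have a configuration U₀ satisfying U₀ ∈ 𝔘_k({Ω_j}, C₁B₃ε₁),
  |Ū₀ʲ − V| < C₁ε₁ on Λ_j, j = 0, 1, …, k, (14) for some absolute constant C₁."  [cite: Balaban1985Variational,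
  (14) p. 280, (28) p. 282]

WHAT IS NOT PRINTED (census HOME/t4/T4-XREAD-U1b-L3.md §3, pages B11 pp. 278–299 read on the renders; null greps
"Lipschitz | response | continuous dependence | two solutions" over the text layers of CMP 102 pp. 277–309 and
255–275: 0 hits): every printed response radius (Prop. 6, p. 296, p. 299, Prop. 7) is const·C₁B₃ε₁, i.e. it reads
the REGULARITY RADIUS of (14), because (28) majorises the residual J by that radius at once; a radius that SEPARATES
the residual (which the cell's NE3 wants → 0 like θ^k) from the regularity radius (which stays ≍ ε₁) is not printed,
nor is a two-data Lipschitz form.  The separated form is the following READING of the displayed lines (this seat's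
[analysis], NOT a quotation): at a solution A₁ of (111) in (115), with x := max{|A₁|_(−1), |∇A₁|_(−2)},
ϱ := max{|𝔊J|_(−1), |∇𝔊J|_(−2)} (≤ B₀|J|_(−3), the step printed inside (117)), b := B₀|B|, K := B₀C₄:
(S1) x ≤ ϱ + K(x + b)² [(111) + the two operator steps printed in (117): Thm 3.13 of [5], Prop. 4 (98), (103)];
(S2) 8K(ε₄ + b) ≤ 1 [(121), second condition] and x ≤ ε₄ give K(x + b)² ≤ (x + b)/8; (S3) hence 7x ≤ 8ϱ + b.
§1 below kernel-checks (S2)–(S3) and the companion INVARIANT-RADIUS remark (the (118)-shaped condition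
ϱ + K(ε + b)² ≤ ε holds for ε := 2ϱ + b); §2 types (S1) and the conclusion as shapes over `B11.LGData` and proves
shape ⇒ shape.  Whether the hypotheses hold for Bałaban's objects — in particular for the competitor NE3 needs
(the block-averaged finer minimiser as "U₀": admissibility (14) ∩ (3.35) of [5] is an obligation, GAPS G-pv21g3-1
(vii)) — is NOT asserted here.

WHAT IS PROVED HERE (all [folklore] real arithmetic / logic):
§1 `quad_le_linear` (K(x+b)² ≤ (x+b)/8 under 8K(ε+b) ≤ 1, x ≤ ε), `apriori_response` (7x ≤ 8ϱ + b),
`apriori_response_sup` (with the printed operator step ϱ ≤ B₀j₃: 7x ≤ 8B₀j₃ + b), `apriori_response_exact`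
(b = 0: x ≤ (8/7)ϱ), `invariant_radius` (ϱ + K((2ϱ + b) + b)² ≤ 2ϱ + b under 8K(2ϱ + 2b) ≤ 1);
§2 shapes `Ineq117At` (= (S1) at a solution), `R1Separated Γ₁ Γ₂` (the residual-separated response), and
`r1Separated_of_ineq117` (`Ineq117At` at every solution in the ball + (121)-smallness ⇒ `R1Separated (8/7) (1/7)`);
`R1Separated.mono` (monotonicity in the constants).  Dictionary to NE3 (HOME/t4/T4-EST-U1b.md §3,
`T4EtaRateMin.localRate_of_residual`): Γ = 8/7 (ϱ-form) resp. (8/7)B₀ (sup-residual form) at the A₁-level; the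
A-level factor 2 of p. 296 "ε₄ = 2(2B₀C₁B₃ε₁ + 2dLB₀C₁ε₁)" and the second-order / orbit-level O(1)(d, L) of p. 299
are NOT separated here (they would need the same reading of (133)).
-/

namespace Literature.MathematicalPhysics.QuantumFieldTheory.Balaban1983to89.T4R1Response

/-! ## §1 Kernel arithmetic of the a-priori response bound (S2)–(S3) -/

/-- (S2): the quadratic term is dominated linearly inside the ball — if `0 ≤ K`, `0 ≤ x + b`, `x ≤ ε` and
`8·K·(ε + b) ≤ 1` (the shape of the second condition in (121), "4B₀C₄(ε₄ + 2dLB₀C₁ε₁) ≤ ½" with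
`2dLB₀C₁ε₁ ≥ B₀|B| = b`), then `K (x + b)² ≤ (x + b)/8`. [folklore] -/
theorem quad_le_linear {K x b ε : ℝ} (hK : 0 ≤ K) (hxb : 0 ≤ x + b) (hxε : x ≤ ε)
    (h8 : 8 * (K * (ε + b)) ≤ 1) : K * (x + b) ^ 2 ≤ (x + b) / 8 := by
  have h1 : K * (x + b) ≤ K * (ε + b) := mul_le_mul_of_nonneg_left (by linarith) hK
  have h2 : K * (x + b) ≤ 1 / 8 := by linarith
  calc K * (x + b) ^ 2 = (K * (x + b)) * (x + b) := by ring
    _ ≤ (1 / 8) * (x + b) := mul_le_mul_of_nonneg_right h2 hxb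
    _ = (x + b) / 8 := by ring

/-- (S3) A-PRIORI RESPONSE: from the (117)-AT-THE-SOLUTION shape `x ≤ ϱ + K (x + b)²` (x = the (115)-norm of the
solution A₁, ϱ = the (115)-norm of 𝔊J, b = B₀|B|, K = B₀C₄), the ball condition `x ≤ ε` and the (121)-shape
smallness `8 K (ε + b) ≤ 1`: `7x ≤ 8ϱ + b`.  The residual datum ϱ and the constraint datum b are SEPARATED from
the regularity radius, which enters only K and the thresholds.  (The READING of (117) at a solution is this seat's
analysis, see the module docstring; the arithmetic is elementary.) [folklore] -/
theorem apriori_response {x ϱ b K ε : ℝ} (hK : 0 ≤ K) (hx : 0 ≤ x) (hb : 0 ≤ b) (hxε : x ≤ ε)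
    (h117 : x ≤ ϱ + K * (x + b) ^ 2) (h121 : 8 * (K * (ε + b)) ≤ 1) : 7 * x ≤ 8 * ϱ + b := by
  have hq := quad_le_linear hK (by linarith) hxε h121
  linarith

/-- The same with the printed operator step "By Theorem 3.13 of [5] … B₀|J|_(−3)" inserted as the hypothesis
`ϱ ≤ B₀ · j₃` (j₃ = |J|_(−3)): `7x ≤ 8 B₀ j₃ + b` — the SUP-residual form (the form in which sub-hazard H-U3-1′
bites, GAPS G-pv21g3-2). [folklore] -/
theorem apriori_response_sup {x ϱ j₃ B₀ b K ε : ℝ} (hK : 0 ≤ K) (hx : 0 ≤ x) (hb : 0 ≤ b) (hxε : x ≤ ε)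
    (h117 : x ≤ ϱ + K * (x + b) ^ 2) (h121 : 8 * (K * (ε + b)) ≤ 1) (h313 : ϱ ≤ B₀ * j₃) :
    7 * x ≤ 8 * (B₀ * j₃) + b := by
  have := apriori_response hK hx hb hxε h117 h121
  linarith

/-- Exact constraints (b = 0, the printed instance being p. 299 "Further, let us notice that B = 0" for U₀ := U_k):
`x ≤ (8/7) ϱ`. [folklore] -/
theorem apriori_response_exact {x ϱ K ε : ℝ} (hK : 0 ≤ K) (hx : 0 ≤ x) (hxε : x ≤ ε)
    (h117 : x ≤ ϱ + K * x ^ 2) (h121 : 8 * (K * ε) ≤ 1) : x ≤ 8 / 7 * ϱ := by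
  have h117' : x ≤ ϱ + K * (x + 0) ^ 2 := by simpa using h117
  have h121' : 8 * (K * (ε + 0)) ≤ 1 := by simpa using h121
  have := apriori_response hK hx le_rfl hxε h117' h121'
  linarith

/-- INVARIANT RADIUS (existence side, the (118)-shape "B₀C₁B₃ε₁ + B₀C₄(ε₄ + 2dLB₀C₁ε₁)² ≤ ε₄" with the residual
separated): for `ε := 2ϱ + b` the condition `ϱ + K (ε + b)² ≤ ε` holds as soon as `8 K (ε + b) ≤ 1` — so the
separated radius is admissible in the invariance step too, not only a-priori. [folklore] -/
theorem invariant_radius {ϱ b K : ℝ} (hϱ : 0 ≤ ϱ) (hb : 0 ≤ b) (hK : 0 ≤ K)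
    (h8 : 8 * (K * ((2 * ϱ + b) + b)) ≤ 1) : ϱ + K * ((2 * ϱ + b) + b) ^ 2 ≤ 2 * ϱ + b := by
  have hq : K * ((2 * ϱ + b) + b) ^ 2 ≤ ((2 * ϱ + b) + b) / 8 :=
    quad_le_linear (x := 2 * ϱ + b) (ε := 2 * ϱ + b) hK (by linarith) le_rfl h8
  linarith

/-! ## §2 The shapes over the tree carrier `B11.LGData`, and shape ⇒ shape -/

open B11 in
/-- (S1) as a shape, AT A SOLUTION: with `ϱ U₀` an abstract "(115)-norm of the linear response 𝔊J(U₀)" (or its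
printed majorant B₀|J|_(−3)), `bB V U₀` an abstract "B₀|B|" and `K` an abstract "B₀C₄", the solution `A₁` of (111)
around `U₀` with data `V` satisfies `nMax U₀ A₁ ≤ ϱ U₀ + K (nMax U₀ A₁ + bB V U₀)²`.  READING of the displayed
(111) + (117)'s two operator steps (Thm 3.13 of [5]; Prop. 4 (98) with (103)); a hypothesis shape, NOT a printed
sentence and NOT a fact — the cite tag names the displayed lines being read.
[cite: Balaban1985Variational, (111) p. 294 and (117) p. 295 (displayed lines read; the shape is not printed)] -/
def Ineq117At (X : LGData) (K : ℝ) (ϱ : X.Cfg → ℝ) (bB : X.Bdry → X.Cfg → ℝ)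
    (V : X.Bdry) (U₀ : X.Cfg) (A₁ : X.Fld) : Prop :=
  X.nMax U₀ A₁ ≤ ϱ U₀ + K * (X.nMax U₀ A₁ + bB V U₀) ^ 2

open B11 in
/-- R1, RESIDUAL-SEPARATED FORM (hypothesis shape; the statement GAPS G-t4-U1b-3 asked to locate, in the typed
reading of G-pv21g3-1 (ii)): every solution `A₁` of (111) around `U₀` (data `V`) lying in the ball
`nMax U₀ A₁ ≤ ε₄` satisfies `nMax U₀ A₁ ≤ Γ₁ · ϱ U₀ + Γ₂ · bB V U₀`.  NOT printed (B11 prints the one-datum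
radius const·C₁B₃ε₁ only, Prop. 6); never to be cited as a fact — the cite tag names the printed one-datum statement
whose separated variant this shape is.
[cite: Balaban1985Variational, Prop. 6 pp. 295–296 (one-datum radius; the separated form is not printed)] -/
def R1Separated (X : LGData) (Γ₁ Γ₂ ε₄ : ℝ) (ϱ : X.Cfg → ℝ) (bB : X.Bdry → X.Cfg → ℝ) : Prop :=
  ∀ (V : X.Bdry) (U₀ : X.Cfg) (A₁ : X.Fld), X.Sol111 V U₀ A₁ → X.nMax U₀ A₁ ≤ ε₄ →
    X.nMax U₀ A₁ ≤ Γ₁ * ϱ U₀ + Γ₂ * bB V U₀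

open B11 in
/-- SHAPE ⇒ SHAPE (the content of §1 transported to the carrier): if (S1) holds at every solution in the ball of
radius `ε₄`, the norms are non-negative, and the (121)-shape smallness `8 K (ε₄ + bB V U₀) ≤ 1` holds, then
`R1Separated X (8/7) (1/7) ε₄ ϱ bB`. [folklore] -/
theorem r1Separated_of_ineq117 (X : LGData) {K ε₄ : ℝ} {ϱ : X.Cfg → ℝ} {bB : X.Bdry → X.Cfg → ℝ}
    (hK : 0 ≤ K) (hn : ∀ (U₀ : X.Cfg) (A₁ : X.Fld), 0 ≤ X.nMax U₀ A₁) (hb : ∀ (V : X.Bdry) (U₀ : X.Cfg), 0 ≤ bB V U₀)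
    (h117 : ∀ (V : X.Bdry) (U₀ : X.Cfg) (A₁ : X.Fld), X.Sol111 V U₀ A₁ → X.nMax U₀ A₁ ≤ ε₄ →
      Ineq117At X K ϱ bB V U₀ A₁)
    (h121 : ∀ (V : X.Bdry) (U₀ : X.Cfg), 8 * (K * (ε₄ + bB V U₀)) ≤ 1) :
    R1Separated X (8 / 7) (1 / 7) ε₄ ϱ bB := by
  intro V U₀ A₁ hsol hball
  have h := apriori_response hK (hn U₀ A₁) (hb V U₀) hball (h117 V U₀ A₁ hsol hball) (h121 V U₀)
  linarith

open B11 in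
/-- Monotonicity of the shape in its constants (bookkeeping for consumers who round Γ up). [folklore] -/
theorem R1Separated.mono (X : LGData) {Γ₁ Γ₂ Γ₁' Γ₂' ε₄ : ℝ} {ϱ : X.Cfg → ℝ} {bB : X.Bdry → X.Cfg → ℝ}
    (h : R1Separated X Γ₁ Γ₂ ε₄ ϱ bB) (h₁ : Γ₁ ≤ Γ₁') (h₂ : Γ₂ ≤ Γ₂')
    (hϱ : ∀ U₀ : X.Cfg, 0 ≤ ϱ U₀) (hb : ∀ (V : X.Bdry) (U₀ : X.Cfg), 0 ≤ bB V U₀) :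
    R1Separated X Γ₁' Γ₂' ε₄ ϱ bB := by
  intro V U₀ A₁ hsol hball
  have := h V U₀ A₁ hsol hball
  have e₁ : Γ₁ * ϱ U₀ ≤ Γ₁' * ϱ U₀ := mul_le_mul_of_nonneg_right h₁ (hϱ U₀)
  have e₂ : Γ₂ * bB V U₀ ≤ Γ₂' * bB V U₀ := mul_le_mul_of_nonneg_right h₂ (hb V U₀)
  linarith

/-! ## §3 Non-vacuity of the arithmetic (numerical instances) -/

/-- The hypotheses of `apriori_response` are jointly satisfiable with a non-trivial conclusion
(K = 1/16, ε = 1, b = 0, ϱ = 31/64, x = 1/2: then x ≤ ϱ + K x² is 1/2 ≤ 31/64 + 1/64 and 7x = 7/2 ≤ 8ϱ = 31/8). -/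
example : 7 * (1 / 2 : ℝ) ≤ 8 * (31 / 64) + 0 :=
  apriori_response (K := 1 / 16) (ε := 1) (by norm_num) (by norm_num) le_rfl (by norm_num)
    (by norm_num) (by norm_num)

end Literature.MathematicalPhysics.QuantumFieldTheory.Balaban1983to89.T4R1Response
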